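import Summits.ResolutionOfSingularities.ResolutionOfSingularities.Theorems.FrobeniusClosingSteerInsepStepReadings
import Summits.ResolutionOfSingularities.ResolutionOfSingularities.Theorems.FrobeniusClosingSteerInsepStepPolyLemma
import Mathlib.Algebra.CharP.Lemmas
import HarnessLib

/-!
# Steer / LEMMA I kernel, file F6b: READINGS AT A DEGREE-FOUR NEAR POINT — the dehomogenisation `θ₂ G = G(1, T, Z') ∈ (S₀[Z'])[T]`, its coefficients
# and degrees, the bivariate `G_E`, Frobenius bookkeeping for double sums

OURS (campaign res-hironaka, rung L ★L-G4, slot W4.1, crux `Steer` stmt-ResolutionOfSingularities-16345; res-L0-w41-plan-1 RULING 155a, kernel of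
res-L0-w41-idea-3's LEMMA I `InsepStepNotIsolated`, degree-FOUR near point; res-L0-w41-stub-3 g7, blueprint `KERNEL-BLUEPRINT-LemmaI.md` 693d33707585fe97
§4 Case C; replaces the role of no printed item; NOT a statement of the manuscript under review [claim: Hironaka2017, status: under-review]; AI review is
weaker than expert review). Theses-free, definition-free; pure polynomial algebra feeding `LemmaI.polyLemma_two`.

* `evalEval_theta₂` — `EV (θ₂ G) = G(1, t, z')` where `θ₂ := eval₂Hom (C ∘ C) (1, T, Z')` and `EV : Z' ↦ z', T ↦ t`;
* `coeff_coeff_theta₂` — for a form `G` of degree `n`: `((θ₂ G).coeff j).coeff k = G.coeff (n − j − k, j, k)`;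
* `degree_coeff_theta₂_lt` — `deg_{Z'} ((θ₂ G).coeff j) < 2N − j` whenever `n < 2N`;
* `evalEval_mem_map_of_forall_coeff_mem` — a nested polynomial with coefficients in `J` evaluates into `J S₁`;
* `evalEval_GE`, `degree_coeff_GE_lt` — value and degree of `G_E = Σ_{j+k ≤ n+1} (a_{jk} + b_{jk} T + c_{jk} Z') Tʲ Z'ᵏ`;
* `sum_sub_sq_sum_eq₂` — Frobenius bookkeeping for double sums in characteristic `2`.
[cite: Matsumura1987, Thm. 17.10] [folklore]
-/

noncomputable section

-- single-problem summit: the doubled namespace component `ResolutionOfSingularities` is forced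
set_option linter.dupNamespace false

namespace Summit.ResolutionOfSingularities.ResolutionOfSingularities.Theorems.SwitchingDichotomy.LemmaI

open IsLocalRing MvPolynomial

/-! ## §1 The dehomogenisation `θ₂` -/

section Theta

variable {S₀ A : Type*} [CommRing S₀] [CommRing A]

/-- **`EV (θ₂ G) = G(1, t, z')`**: composing the dehomogenisation `θ₂ := eval₂Hom (C ∘ C) (1, T, Z')` with the nested evaluation `Z' ↦ z'`, `T ↦ t`
through `φ : S₀ → A` is the evaluation of `G` at `(1, t, z')`. [folklore] -/
theorem evalEval_theta₂ (φ : S₀ →+* A) (t z : A) (G : MvPolynomial (Fin 3) S₀) :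
    (eval₂ (Polynomial.C.comp Polynomial.C) ![1, Polynomial.X, Polynomial.C Polynomial.X] G).eval₂ (Polynomial.eval₂RingHom φ z) t =
      eval₂ φ ![1, t, z] G := by
  rw [← coe_eval₂Hom, ← coe_eval₂Hom, ← Polynomial.coe_eval₂RingHom, ← RingHom.comp_apply]
  congr 1
  refine ringHom_ext (fun c => by simp) (fun i => ?_)
  fin_cases i <;> simp

/-- The exponent `(n − j − k, j, k)`: values. [folklore] -/
theorem layer₂_apply (n j k : ℕ) :
    (Finsupp.single (0 : Fin 3) (n - j - k) + Finsupp.single (1 : Fin 3) j + Finsupp.single (2 : Fin 3) k : Fin 3 →₀ ℕ) (0 : Fin 3) = n - j - k ∧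
    (Finsupp.single (0 : Fin 3) (n - j - k) + Finsupp.single (1 : Fin 3) j + Finsupp.single (2 : Fin 3) k : Fin 3 →₀ ℕ) (1 : Fin 3) = j ∧
    (Finsupp.single (0 : Fin 3) (n - j - k) + Finsupp.single (1 : Fin 3) j + Finsupp.single (2 : Fin 3) k : Fin 3 →₀ ℕ) (2 : Fin 3) = k := by
  refine ⟨?_, ?_, ?_⟩ <;> simp

/-- A monomial exponent on `Fin 3` with prescribed values. [folklore] -/
theorem eq_layer₂_of_apply {m : Fin 3 →₀ ℕ} {n j k : ℕ} (h0 : m 0 = n - j - k) (h1 : m 1 = j) (h2 : m 2 = k) :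
    m = Finsupp.single (0 : Fin 3) (n - j - k) + Finsupp.single 1 j + Finsupp.single 2 k := by
  obtain ⟨e0, e1, e2⟩ := layer₂_apply n j k
  ext i
  fin_cases i
  · exact h0.trans e0.symm
  · exact h1.trans e1.symm
  · exact h2.trans e2.symm

/-- **Coefficients of `θ₂ G` for a form `G` of degree `n`**: `((θ₂ G).coeff j).coeff k = G.coeff (n − j − k, j, k)`. [folklore] -/
theorem coeff_coeff_theta₂ {G : MvPolynomial (Fin 3) S₀} {n : ℕ} (hG : G.IsHomogeneous n) (j k : ℕ) :
    ((eval₂ (Polynomial.C.comp Polynomial.C) ![1, Polynomial.X, Polynomial.C Polynomial.X] G).coeff j).coeff k =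
      G.coeff (Finsupp.single (0 : Fin 3) (n - j - k) + Finsupp.single 1 j + Finsupp.single 2 k) := by
  classical
  obtain ⟨e0, e1, e2⟩ := layer₂_apply n j k
  set e : Fin 3 →₀ ℕ := Finsupp.single (0 : Fin 3) (n - j - k) + Finsupp.single 1 j + Finsupp.single 2 k with he
  rw [eval₂_eq', Polynomial.finsetSum_coeff, Polynomial.finsetSum_coeff]
  have hterm : ∀ m : Fin 3 →₀ ℕ, (((Polynomial.C.comp Polynomial.C) (G.coeff m) *
      ∏ i, (![1, Polynomial.X, Polynomial.C Polynomial.X] : Fin 3 → Polynomial (Polynomial S₀)) i ^ m i).coeff j).coeff k =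
      if m 1 = j ∧ m 2 = k then G.coeff m else 0 := by
    intro m
    rw [Fin.prod_univ_three]
    show ((Polynomial.C (Polynomial.C (G.coeff m)) *
      ((1 : Polynomial (Polynomial S₀)) ^ m 0 * Polynomial.X ^ m 1 * (Polynomial.C Polynomial.X) ^ m 2)).coeff j).coeff k = _
    have hre : (Polynomial.C (Polynomial.C (G.coeff m)) *
        ((1 : Polynomial (Polynomial S₀)) ^ m 0 * Polynomial.X ^ m 1 * (Polynomial.C Polynomial.X) ^ m 2) : Polynomial (Polynomial S₀)) =
        Polynomial.C (Polynomial.C (G.coeff m) * Polynomial.X ^ m 2) * Polynomial.X ^ m 1 := by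
      rw [one_pow, one_mul, ← map_pow, map_mul]; ring
    rw [hre, Polynomial.coeff_C_mul_X_pow]
    by_cases h1 : m 1 = j
    · rw [if_pos h1.symm, Polynomial.coeff_C_mul_X_pow]
      by_cases h2 : m 2 = k
      · simp [h1, h2]
      · have h2' : ¬ k = m 2 := fun e => h2 e.symm
        simp [h1, h2, h2']
    · have h1' : ¬ j = m 1 := fun e => h1 e.symm
      rw [if_neg h1', Polynomial.coeff_zero]
      simp [h1]
  simp_rw [hterm]
  rw [Finset.sum_eq_single e]
  · simp [e1, e2]
  · intro m hm hme
    rw [if_neg]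
    rintro ⟨h1, h2⟩
    apply hme
    have hdeg : m.degree = n := degree_eq_of_coeff_ne_zero hG (mem_support_iff.mp hm)
    rw [Finsupp.degree_eq_sum, Fin.sum_univ_three, h1, h2] at hdeg
    exact eq_layer₂_of_apply (by omega) h1 h2
  · intro hne
    rw [notMem_support_iff.mp hne]
    simp

/-- **Degree bound**: for a form `G` of degree `n < 2N`, `deg_{Z'} ((θ₂ G).coeff j) < 2N − j` for every `j`. [folklore] -/
theorem degree_coeff_theta₂_lt {G : MvPolynomial (Fin 3) S₀} {n : ℕ} (hG : G.IsHomogeneous n) {N : ℕ} (hn : n < 2 * N) (j : ℕ) :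
    ((eval₂ (Polynomial.C.comp Polynomial.C) ![1, Polynomial.X, Polynomial.C Polynomial.X] G).coeff j).degree <
      ((2 * N - j : ℕ) : WithBot ℕ) := by
  have hcoeff0 : ∀ k, n < j + k →
      ((eval₂ (Polynomial.C.comp Polynomial.C) ![1, Polynomial.X, Polynomial.C Polynomial.X] G).coeff j).coeff k = 0 := by
    intro k hk
    rw [coeff_coeff_theta₂ hG]
    refine hG.coeff_eq_zero ?_
    rw [map_add, map_add, Finsupp.degree_single, Finsupp.degree_single, Finsupp.degree_single]
    omega
  by_cases hj : n < j
  · have : (eval₂ (Polynomial.C.comp Polynomial.C) ![1, Polynomial.X, Polynomial.C Polynomial.X] G).coeff j = 0 := by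
      ext k; rw [hcoeff0 k (by omega), Polynomial.coeff_zero]
    rw [this, Polynomial.degree_zero]
    exact WithBot.bot_lt_coe _
  · have hle : ((eval₂ (Polynomial.C.comp Polynomial.C) ![1, Polynomial.X, Polynomial.C Polynomial.X] G).coeff j).degree ≤
        ((n - j : ℕ) : WithBot ℕ) := by
      rw [Polynomial.degree_le_iff_coeff_zero]
      intro k hk
      have hk' : n - j < k := by exact_mod_cast hk
      exact hcoeff0 k (by omega)
    exact hle.trans_lt (by exact_mod_cast (show n - j < 2 * N - j by omega))

end Theta

/-! ## §2 Nested evaluation with coefficients in an ideal; the bivariate `G_E`; Frobenius for double sums -/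

section Nested

variable {S₀ A : Type*} [CommRing S₀] [CommRing A]

/-- A nested polynomial all of whose coefficients lie in `J` evaluates into `J A`. [folklore] -/
theorem evalEval_mem_map_of_forall_coeff_mem (φ : S₀ →+* A) (t z : A) {J : Ideal S₀} {G : Polynomial (Polynomial S₀)}
    (hG : ∀ j k, (G.coeff j).coeff k ∈ J) : G.eval₂ (Polynomial.eval₂RingHom φ z) t ∈ J.map φ := by
  rw [Polynomial.eval₂_eq_sum_range]
  exact Submodule.sum_mem _ fun j _ =>
    Ideal.mul_mem_right _ _ (by rw [Polynomial.coe_eval₂RingHom]; exact eval₂_mem_map_of_forall_coeff_mem φ z (hG j))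

/-- **Value of `G_E = Σ_{p ∈ T} (a_p + b_p T + c_p Z') T^{p.1} Z'^{p.2}`** under `EV`. [folklore] -/
theorem evalEval_GE (φ : S₀ →+* A) (t z : A) (T : Finset (ℕ × ℕ)) (a b c : ℕ × ℕ → S₀) :
    (∑ p ∈ T, (Polynomial.C (Polynomial.C (a p)) + Polynomial.C (Polynomial.C (b p)) * Polynomial.X +
        Polynomial.C (Polynomial.C (c p) * Polynomial.X)) * Polynomial.C (Polynomial.X ^ p.2) * Polynomial.X ^ p.1).eval₂
        (Polynomial.eval₂RingHom φ z) t =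
      ∑ p ∈ T, (φ (a p) + φ (b p) * t + φ (c p) * z) * z ^ p.2 * t ^ p.1 := by
  rw [Polynomial.eval₂_finsetSum]
  refine Finset.sum_congr rfl fun p _ => ?_
  simp [Polynomial.eval₂_add, Polynomial.eval₂_mul, Polynomial.eval₂_pow]

/-- **Degree of the `T`-coefficients of `G_E`**: if every `p ∈ T` has `p.1 + p.2 ≤ n + 1` and `n + 2 < 2N`, then `deg_{Z'} (coeff_j G_E) < 2N − j`. [folklore] -/
theorem degree_coeff_GE_lt [Nontrivial S₀] (T : Finset (ℕ × ℕ)) (a b c : ℕ × ℕ → S₀) {n N : ℕ} (hT : ∀ p ∈ T, p.1 + p.2 ≤ n + 1)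
    (hN : n + 2 < 2 * N) (j : ℕ) :
    ((∑ p ∈ T, (Polynomial.C (Polynomial.C (a p)) + Polynomial.C (Polynomial.C (b p)) * Polynomial.X +
        Polynomial.C (Polynomial.C (c p) * Polynomial.X)) * Polynomial.C (Polynomial.X ^ p.2) * Polynomial.X ^ p.1).coeff j).degree <
      ((2 * N - j : ℕ) : WithBot ℕ) := by
  rw [Polynomial.finsetSum_coeff]
  refine (Polynomial.degree_sum_le _ _).trans_lt ((Finset.sup_lt_iff (WithBot.bot_lt_coe _)).mpr fun p hp => ?_)
  have hpk := hT p hp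
  -- the `T`-coefficient `j` of one term
  have hterm : ((Polynomial.C (Polynomial.C (a p)) + Polynomial.C (Polynomial.C (b p)) * Polynomial.X +
      Polynomial.C (Polynomial.C (c p) * Polynomial.X)) * Polynomial.C (Polynomial.X ^ p.2) * Polynomial.X ^ p.1 : Polynomial (Polynomial S₀)) =
      Polynomial.C ((Polynomial.C (a p) + Polynomial.C (c p) * Polynomial.X) * Polynomial.X ^ p.2) * Polynomial.X ^ p.1 +
        Polynomial.C (Polynomial.C (b p) * Polynomial.X ^ p.2) * Polynomial.X ^ (p.1 + 1) := by
    simp only [map_add, map_mul, map_pow, pow_succ]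
    ring
  rw [hterm, Polynomial.coeff_add, Polynomial.coeff_C_mul_X_pow, Polynomial.coeff_C_mul_X_pow]
  have hdeg1 : ((Polynomial.C (a p) + Polynomial.C (c p) * Polynomial.X) * Polynomial.X ^ p.2 : Polynomial S₀).degree ≤ (p.2 + 1 : ℕ) := by
    refine (Polynomial.degree_mul_le _ _).trans ?_
    rw [Polynomial.degree_X_pow, Nat.cast_add, Nat.cast_one, add_comm]
    gcongr
    refine (Polynomial.degree_add_le _ _).trans (max_le ?_ ?_)
    · exact Polynomial.degree_C_le.trans (by exact_mod_cast Nat.zero_le 1)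
    · exact Polynomial.degree_C_mul_X_le _
  by_cases hj1 : j = p.1
  · subst hj1
    rw [if_pos rfl, if_neg (by omega), add_zero]
    exact hdeg1.trans_lt (by exact_mod_cast (show p.2 + 1 < 2 * N - p.1 by omega))
  · rw [if_neg hj1]
    by_cases hj2 : j = p.1 + 1
    · subst hj2
      rw [if_pos rfl, zero_add]
      exact (Polynomial.degree_C_mul_X_pow_le _ _).trans_lt (by exact_mod_cast (show p.2 < 2 * N - (p.1 + 1) by omega))
    · rw [if_neg hj2, add_zero, Polynomial.degree_zero]
      exact WithBot.bot_lt_coe _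

/-- **Frobenius bookkeeping for double sums** in characteristic `2`: with `s p = 0` unless both exponents are even,
`Σ φ(c_p) z^{k} t^{j} − (Σ φ(s_p) z^{k/2} t^{j/2})² = Σ φ(c_p − s_p²) z^{k} t^{j}`. [folklore] -/
theorem sum_sub_sq_sum_eq₂ [CharP A 2] (φ : S₀ →+* A) (t z : A) (T : Finset (ℕ × ℕ)) (c s : ℕ × ℕ → S₀)
    (hs : ∀ p, ¬ (Even p.1 ∧ Even p.2) → s p = 0) :
    (∑ p ∈ T, φ (c p) * z ^ p.2 * t ^ p.1) - (∑ p ∈ T, φ (s p) * z ^ (p.2 / 2) * t ^ (p.1 / 2)) ^ 2 =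
      ∑ p ∈ T, φ (c p - s p ^ 2) * z ^ p.2 * t ^ p.1 := by
  have hsq : (∑ p ∈ T, φ (s p) * z ^ (p.2 / 2) * t ^ (p.1 / 2)) ^ 2 = ∑ p ∈ T, φ (s p ^ 2) * z ^ p.2 * t ^ p.1 := by
    rw [← frobenius_def, map_sum]
    refine Finset.sum_congr rfl fun p _ => ?_
    rw [frobenius_def, mul_pow, mul_pow, ← map_pow, ← pow_mul, ← pow_mul]
    by_cases hp : Even p.1 ∧ Even p.2
    · rw [Nat.div_mul_cancel (even_iff_two_dvd.mp hp.1), Nat.div_mul_cancel (even_iff_two_dvd.mp hp.2)]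
    · rw [hs p hp]; simp
  rw [hsq, ← Finset.sum_sub_distrib]
  refine Finset.sum_congr rfl fun p _ => ?_
  rw [map_sub, map_pow]
  ring

end Nested

end Summit.ResolutionOfSingularities.ResolutionOfSingularities.Theorems.SwitchingDichotomy.LemmaI

end
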